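/-
Copyright (c) 2026 the pub-hodgecm-mathlib formalisation cell (harness21).  Prover seat hodgecm-mathlib-LH4-p10 (g6): Track A «(D-RAM) FOUR-FRAME» squad of crux H413, STAGE-1b,
dealer LH4-plan (g13) WORD #66 (1) «(NV-§0-RamM) `tube_of_conductor_le_ramM`» (the RamM twin of ★ p859839 §0).  2026-09-04.
-/
import Summits.HodgeConjecture.HodgeConjecture.Theorems.F0P3cDyRamTypeTwoLevelDictionary                -- ★ p858041 (LH4-p11 (g5)): `sq_sub_map_eq_map_disc`
import Literature.NumberTheory.Automorphic.UnitaryThreeFourFrameDefs                                 -- ★ #0a: `IsRamifiedQuadraticDatum`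
import HarnessLib

/-!
# F0 · P3c · line LH4 «(D-RAM) FOUR-FRAME» — STAGE-1b, (NV-§0-RamM): THE TUBE FROM THE CONDUCTOR TOKEN FOR A RAMIFIED LINE MODEL (`|jE a| = |a|²`)

Cell `pub/hodgecm-mathlib` (D-0151), crux H413 = `stmt-HodgeConjecture-24833` (helper lane `--supports stmt-HodgeConjecture-24833 --as helper`, count-neutral); ONE THEOREM
(pure valuation arithmetic on an abstract tower `jE : E →+* M`; no definition, no instance, no notation, no `sorry`, default heartbeats).

WHY.  ★ p859839 `F0P3cDyRamHSideClosedFormConeTokens.tube_of_conductor_le` gives the TUBE `|t² − 4D| < |4|·|ϖ|²·|t|²` of ★ p857701 `hSide_closedForm_of_tube_exists` from the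
conductor token for an ISOMETRIC line model (types U, RamK: `|jE a| = |a|`).  The type-RamM (LAW) END of LH4-p07 (g9) (`levels_typeTwo_censusLaw_*_ofRecord`, RamM branch; twin
of ★ `orderCountCensusC`) feeds ★ `hSide_closedForm_ramM_hLevel` (LH4-p09 (g6)), whose `htube` input it must produce from its near-1 letters; there the line model `M = E′_{w₁}`
is RAMIFIED over `L_w` (`|jE a|_M = |a|_w²`) and the conductor is read in ★ `hSide_closedForm_ramM_hLevel`'s own spelling `|lam − ρ lam| = |jE ϖ ^ jl · (ϖ_M − ρ ϖ_M)|`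
with a `ρ`-datum `IsRamifiedQuadraticDatum ρ ϖ_M dρ tρ` on `M`.  This file is that one call:
* `tube_of_conductor_le_ramM` — `|jE a| = |a|²`, eigen-package `ρ lam = jE t − lam`, `lam² = jE t·lam − jE D`, `|ϖ|_E = exp(−1)`, `|2|_E = |ϖ|^{tE}`, trace token `|t| = |2|`,
  `ρ`-datum `(ϖ_M, dρ)`, conductor `|lam − ρ lam| = |jE ϖ ^ jl·(ϖ_M − ρ ϖ_M)|`, and `2·tE + 2 ≤ jl` ⟹ `|t² − 4D| < |4|·|ϖ|²·|t|²`
  (squares compared in `ℤᵐ⁰`: `|t² − 4D|² = |lam − ρ lam|² = exp(−2(2jl + dρ))` by ★ `sq_sub_map_eq_map_disc`, `(|4|·|ϖ|²·|t|²)² = exp(−2(4tE + 2))`).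
HONEST LABEL: HC_CM is proved only modulo the 7 printed citations (2 remaining named inputs: hLiu418 = stmt-HodgeConjecture-24832, h413 = stmt-HodgeConjecture-24833) until rung 0
closes; count-neutral; no census, no law.

## References
* [LabesseLanglands1979] J.-P. Labesse, R. P. Langlands, *L-indistinguishability for SL(2)*, Canad. J. Math. 31 (1979), §2 pp. 7–8 (quadratic tori, conductor, fixed balls).
* [Rogawski1990] J. D. Rogawski, *Automorphic Representations of Unitary Groups in Three Variables*, Ann. of Math. Stud. 123 (1990), §4.9 Lemma 4.9.3 p. 56.
-/

set_option autoImplicit false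

namespace Summit.HodgeConjecture.HodgeConjecture.Cruxes.H413.F0P3cDyRamHSideTubeOfConductorRamM

open scoped WithZero
open Literature.NumberTheory.Automorphic.UnitaryThreeFourFrame
open Summit.HodgeConjecture.HodgeConjecture.Cruxes.H413.F0P3cDyRamTypeTwoLevelDictionary (sq_sub_map_eq_map_disc)

variable {E M : Type} [Field E] [Field M] [Valued E ℤᵐ⁰] [Valued M ℤᵐ⁰]

/-- **(NV-§0-RamM) THE TUBE FROM THE CONDUCTOR TOKEN, RAMIFIED LINE MODEL.**  For `jE : E →+* M` with `|jE a| = |a|²`, an eigen-package `ρ lam = jE t − lam`,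
`lam² = jE t·lam − jE D`, a uniformiser `ϖ` of `E` with `|2| = |ϖ|^{tE}`, the trace token `|t| = |2|`, a `ρ`-datum `IsRamifiedQuadraticDatum ρ ϖ_M dρ tρ` on `M` and the conductor
token in ★ `hSide_closedForm_ramM_hLevel`'s spelling `|lam − ρ lam| = |jE ϖ ^ jl · (ϖ_M − ρ ϖ_M)|`: if `2·tE + 2 ≤ jl`, then `|t² − 4D| < |4|·|ϖ|²·|t|²` (the `htube` input of
★ `hSide_closedForm_ramM_hLevel` ∕ ★ p857701).  [cite: LabesseLanglands1979, §2 pp. 7–8] [cite: Rogawski1990, §4.9 Lemma 4.9.3 p. 56] -/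
theorem tube_of_conductor_le_ramM (jE : E →+* M) (hjE2 : ∀ x, Valued.v (jE x) = Valued.v x ^ 2)
    {ρ : M →+* M} {lam : M} {t D : E} (hρlam : ρ lam = jE t - lam) (hlam2 : lam * lam = jE t * lam - jE D)
    {ϖ : E} (hϖ : Valued.v ϖ = WithZero.exp (-1 : ℤ)) {tE : ℕ} (h2 : Valued.v (2 : E) = Valued.v ϖ ^ tE)
    (htr : Valued.v t = Valued.v (2 : E))
    {ϖM : M} {dρ tρ : ℕ} (hDρ : IsRamifiedQuadraticDatum ρ ϖM dρ tρ)
    {jl : ℕ} (hjl : Valued.v (lam - ρ lam) = Valued.v (jE ϖ ^ jl * (ϖM - ρ ϖM))) (hle : 2 * tE + 2 ≤ jl) :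
    Valued.v (t ^ 2 - 4 * D) < Valued.v (4 : E) * Valued.v ϖ ^ 2 * Valued.v t ^ 2 := by
  have hϖM : Valued.v ϖM = WithZero.exp (-1 : ℤ) := hDρ.2.2.1
  have hdρ : Valued.v (ϖM - ρ ϖM) = Valued.v ϖM ^ dρ := hDρ.2.2.2.2.1
  have hsq := sq_sub_map_eq_map_disc jE hρlam hlam2
  -- the conductor token in `exp` form: `|lam − ρ lam| = exp(−(2jl + dρ))`
  have hjlv : Valued.v (lam - ρ lam) = WithZero.exp (-((2 * jl + dρ : ℕ) : ℤ)) := by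
    rw [hjl, map_mul, map_pow, hjE2, hϖ, hdρ, hϖM, ← pow_mul, ← pow_add, ← WithZero.exp_nsmul, nsmul_eq_mul, mul_neg, mul_one]
  -- squares: `|t² − 4D|² = |jE (t² − 4D)| = |lam − ρ lam|²`
  have hL2 : Valued.v (t ^ 2 - 4 * D) ^ 2 = WithZero.exp (-(2 * ((2 * jl + dρ : ℕ) : ℤ))) := by
    rw [← hjE2, ← hsq, map_pow, hjlv, ← WithZero.exp_nsmul, nsmul_eq_mul]; congr 1; ring
  have hR : Valued.v (4 : E) * Valued.v ϖ ^ 2 * Valued.v t ^ 2 = WithZero.exp (-((4 * tE + 2 : ℕ) : ℤ)) := by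
    rw [htr, show (4 : E) = 2 ^ 2 by norm_num, map_pow, h2, hϖ, ← pow_mul, ← pow_add, ← pow_add, ← WithZero.exp_nsmul, nsmul_eq_mul, mul_neg, mul_one]
    congr 2; push_cast; ring
  refine lt_of_not_ge fun hge => ?_
  have h := pow_le_pow_left' hge 2
  rw [hR, hL2, ← WithZero.exp_nsmul, nsmul_eq_mul, WithZero.exp_le_exp] at h
  push_cast at h
  omega

end Summit.HodgeConjecture.HodgeConjecture.Cruxes.H413.F0P3cDyRamHSideTubeOfConductorRamM
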